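import Summits.FinalStateConjecture.FinalStateConjecture.Theorems.ExactKerrEndsTameEscapeToKerrEndsTameJunctionPrep
import Literature.Geometry.Lorentzian.ExactKerrEnd
import Literature.Geometry.Lorentzian.TameBreathingCurve
import Literature.Geometry.Lorentzian.TameFamilyFarSurgery
import HarnessLib

/-!
# Route `ExactKerrEnds`, crux `TameEscapeToKerrEnds` (stmt-FinalStateConjecture-18522), line
# `matched-kerr-solution-map`: stub S3b `TameJunction`

**The tame junction.** From a radius-indexed family `G R` (`R > R⋆ > e.R`) of admissible
Kerr-ended data on `X` agreeing with the admissible datum `d` off the far region `e.far R`,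
Dafermos–Rodnianski flat on the sole end `e` with masses `m R → M` (`m` continuous), jointly
smooth in `(R, x)`, with `e.wDist (G R) d → 0`, we produce an end `e'` and a curve
`F : ℝ¹ → InitialDataSet (𝓡 3) X` which is TAME on `e'`, IMMERSED at `0`, injective, through
`d = F 0`, with admissible members, Kerr-ended off `0`.

Construction (the landed `junction` / `stub_breathing` pattern of the sibling crux
`SwallowTheDatum.ParametricKerrBurial`, read with the breathing parameter `t = c₀` itself):
choose a breathing ball below `R⋆` on the end (`exists_breathingData_le`), let
`S (R, t) := breathe(σ t)^* (G R)`, `E t := breathe(σ t)^* d` (`AFEnd.breatheFamily`) and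
`F c := S (R⋆ + 1 + ‖c‖⁻², c₀)` for `c ≠ 0`, `F 0 := d`. Then

* `F` is jointly smooth: off `c = 0` by composition, at `c = 0` by local exhaustion
  (`AFEnd.exists_nhds_forall_not_mem_far`) and agreement with the breathing curve `c ↦ E c₀`;
* `F` is injective: the centre marker `h_{F c}(x₀)(v₀, v₀) = (1 + σ c₀)² h_d(x₀)(v₀, v₀)`
  (`AFEnd.injective_marker`);
* every `F c`, `c ≠ 0`, is admissible (naturality of the constraints + `AdmissibleDataLocality`)
  and Kerr-ended (`HasExactKerrEnd.breatheFamily`: breathing moves a compact core);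
* `F` is TAME on the collared end `e' := e.restrict _` at radius `R⋆` and IMMERSED at `0`, by the
  far-surgery transfer `IsTameDataFamily.of_wDist_tendsto_of_forall_eventuallyEq` from the
  breathing curve `c ↦ E c₀` of `d` (tame: `isTameDataFamily_restrict_breatheCurve`; immersed:
  `isImmersedAtZero_breatheCurve`): beyond `R⋆` the member `F c` reads `G (R c)` and `E c₀` reads
  `d`, so `e'.wDist (F c) (E c₀) ≤ e.wDist (G (R c)) d → 0` as `c → 0` (`R c → ∞`); the mass
  function `c ↦ m (R c)` (`M` at `0`) is continuous; and `F c = E c₀` at every point for `c`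
  near `0`.

Everything is proved; no definitions, no named facts. The collar / reparametrisation / breathing
bookkeeping is `ExactKerrEndsTameEscapeToKerrEndsTameJunctionPrep.lean`.
-/

set_option linter.dupNamespace false

noncomputable section

namespace Summit.FinalStateConjecture.FinalStateConjecture.Theorems.ExactKerrEnds

open scoped Manifold ContDiff Topology ENNReal
open Bundle Set Filter Function Metric TopologicalSpace Literature.Geometry.Lorentzian
open Summit.FinalStateConjecture.FinalStateConjecture.Theorems.SwallowTheDatum
  (AFEnd.exists_nhds_forall_not_mem_far)
open Summit.FinalStateConjecture.FinalStateConjecture.Theorems.SwallowTheDatum.ParametricKerrBurial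
  (SmoothSectionsOn AgreeAt radiusOf radiusOf_gt contDiffOn_radiusOf lt_inv_norm_sq
    exists_breathingData_le not_mem_far_of_mem_carrier)

/-! ## §4 The stub -/

/-- **Registered stub S3b `TameJunction` of crux `TameEscapeToKerrEnds` (stmt-FinalStateConjecture-18522),
line `matched-kerr-solution-map` — the tame junction.** From a radius-indexed family `G R`
(`R > R⋆ > e.R`) of admissible Kerr-ended data agreeing with the admissible datum `d` off
`e.far R`, Dafermos–Rodnianski flat on the sole end `e` with masses `m R → M` (`m` continuous on
`(R⋆, ∞)`), jointly smooth in `(R, x)`, with `e.wDist (G R) d → 0`: an end `e'` (the collar of `e`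
at radius `R⋆`) and a curve `F` (`F c := breathe(σ c₀)^* (G (R⋆ + 1 + ‖c‖⁻²))`, `F 0 := d`) which is
tame on `e'`, immersed at `0`, through `d`, injective, with admissible members, Kerr-ended off `0`.
Christodoulou, CQG 16 (1999) A23, p. A24 (witness curves in a fixed space of data); Lee 2013,
Prop. 2.25 (bump diffeomorphisms); Bartnik–Isenberg 2004, §2 (covariance of the constraints).
[cite: Christodoulou1999, p. A24] -/
theorem tameJunction :
    ∀ (X : Type) [TopologicalSpace X] [ChartedSpace E3 X] [IsManifold (𝓡 3) ∞ X] [T2Space X]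
      [SecondCountableTopology X] [ConnectedSpace X],
      ∀ (d : InitialDataSet (𝓡 3) X) (e : AFEnd X) (M Rstar : ℝ) (m : ℝ → ℝ)
        (G : ℝ → InitialDataSet (𝓡 3) X),
        d ∈ admissibleVacuumData X → e.IsSoleEnd → e.IsStronglyAsymptoticallyFlatDR d M → e.R < Rstar →
        ContinuousOn m (Ioi Rstar) → Tendsto m atTop (𝓝 M) →
        SmoothSectionsOn 𝓘(ℝ, ℝ) G {p : ℝ × X | Rstar < p.1} →
        (∀ R : ℝ, Rstar < R →
          G R ∈ admissibleVacuumData X ∧ (∀ x ∉ e.far R, AgreeAt (G R) d x) ∧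
            e.IsStronglyAsymptoticallyFlatDR (G R) (m R) ∧ (G R).HasExactKerrEnd) →
        Tendsto (fun R ↦ e.wDist (G R) d) atTop (𝓝 0) →
        ∃ (e' : AFEnd X) (F : EuclideanSpace ℝ (Fin 1) → InitialDataSet (𝓡 3) X),
          InitialDataSet.IsTameDataFamily e' 1 F ∧ InitialDataSet.IsImmersedAtZero 1 F ∧ F 0 = d ∧
            Injective F ∧ (∀ c, F c ∈ admissibleVacuumData X) ∧ ∀ c ≠ 0, (F c).HasExactKerrEnd := by
  intro X _ _ _ _ _ _ d e M Rstar m G hd hsole hDR hR hm hmM hG hGR hw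
  classical
  -- the breathing ball below `R⋆`
  obtain ⟨z₀, r, B, hzr⟩ := exists_breathingData_le e hR
  have hGd : ∀ R : ℝ, Rstar < R → ∀ x ∉ e.far R, AgreeAt (G R) d x := fun R hRR ↦ (hGR R hRR).2.1
  have hRstar : 0 ≤ Rstar + 1 := by linarith [e.R_pos]
  -- the family `F`, packaged by its two defining clauses, and the mass function
  obtain ⟨F, hF0, hFne⟩ : ∃ F : EuclideanSpace ℝ (Fin 1) → InitialDataSet (𝓡 3) X,
      F 0 = d ∧ ∀ c ≠ 0, F c = AFEnd.breatheFamily B (G (radiusOf Rstar c)) (c 0) :=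
    ⟨fun c ↦ if c = 0 then d else AFEnd.breatheFamily B (G (radiusOf Rstar c)) (c 0), if_pos rfl,
      fun c hc ↦ if_neg hc⟩
  obtain ⟨M', hM'0, hM'ne⟩ : ∃ M' : EuclideanSpace ℝ (Fin 1) → ℝ,
      M' 0 = M ∧ ∀ c ≠ 0, M' c = m (radiusOf Rstar c) :=
    ⟨fun c ↦ if c = 0 then M else m (radiusOf Rstar c), if_pos rfl, fun c hc ↦ if_neg hc⟩
  have h00 : ((0 : EuclideanSpace ℝ (Fin 1)) 0 : ℝ) = 0 := rfl
  -- `S (R, t) := breathe(σ t)^*(G R)` agrees with `E t := breathe(σ t)^* d` off `e.far R`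
  have hSE : ∀ R t : ℝ, Rstar < R → ∀ x ∉ e.far R,
      AgreeAt (AFEnd.breatheFamily B (G R) t) (AFEnd.breatheFamily B d t) x :=
    fun R t hRR x hx ↦ agreeAt_breatheFamily B t (agreeAt_breathe_of_not_mem_far B hzr hGd hRR t hx)
  -- far sections beyond `R⋆`: `S (R, t)` reads `G R`, `E t` reads `d`
  have hfarS : ∀ (R t : ℝ), ∀ q ∈ e.far Rstar,
      (AFEnd.breatheFamily B (G R) t).h.inner q = (G R).h.inner q ∧
        (AFEnd.breatheFamily B (G R) t).k q = (G R).k q :=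
    fun R t q hq ↦ AFEnd.breatheFamily_eq_of_mem_far B (G R) t hzr hq
  have hfarE : ∀ t : ℝ, ∀ q ∈ e.far Rstar,
      (AFEnd.breatheFamily B d t).h.inner q = d.h.inner q ∧ (AFEnd.breatheFamily B d t).k q = d.k q :=
    fun t q hq ↦ AFEnd.breatheFamily_eq_of_mem_far B d t hzr hq
  -- joint smoothness of `F`
  have hSsm := smoothSectionsOn_breatheFamily_radius B hzr hGd hG
  have hE0 : AFEnd.breatheFamily B d 0 = d := AFEnd.breatheFamily_zero B d
  have hFsm : InitialDataSet.IsSmoothDataFamily 1 F :=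
    ⟨contMDiff_section_of_radiusCoord d e hRstar (fun q : ℝ × ℝ ↦ AFEnd.breatheFamily B (G q.1) q.2)
        (fun t ↦ AFEnd.breatheFamily B d t) (fun D x ↦ D.h.inner x) hSsm.1
        (AFEnd.contMDiff_breatheFamily_h B d) (fun x ↦ by rw [hE0])
        (fun R t hRR x hx ↦ (hSE R t hRR x hx).1) F hF0 hFne,
      contMDiff_section_of_radiusCoord d e hRstar (fun q : ℝ × ℝ ↦ AFEnd.breatheFamily B (G q.1) q.2)
        (fun t ↦ AFEnd.breatheFamily B d t) (fun D x ↦ D.k x) hSsm.2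
        (AFEnd.contMDiff_breatheFamily_k B d) (fun x ↦ by rw [hE0])
        (fun R t hRR x hx ↦ (hSE R t hRR x hx).2) F hF0 hFne⟩
  -- `R c → ∞` as `c → 0`, `c ≠ 0`
  have hRc : Tendsto (radiusOf Rstar) (𝓝[≠] (0 : EuclideanSpace ℝ (Fin 1))) atTop := by
    have h1 : Tendsto (fun c : EuclideanSpace ℝ (Fin 1) ↦ ‖c‖ ^ 2) (𝓝[≠] 0) (𝓝[>] 0) := by
      refine tendsto_nhdsWithin_iff.2 ⟨?_, ?_⟩
      · have h : Tendsto (fun c : EuclideanSpace ℝ (Fin 1) ↦ ‖c‖ ^ 2) (𝓝 0)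
            (𝓝 (‖(0 : EuclideanSpace ℝ (Fin 1))‖ ^ 2)) :=
          (continuous_norm.pow 2).tendsto 0
        rw [norm_zero, zero_pow two_ne_zero] at h
        exact h.mono_left nhdsWithin_le_nhds
      · filter_upwards [self_mem_nhdsWithin] with c hc
        exact pow_pos (norm_pos_iff.2 hc) 2
    have h2 : Tendsto (fun c : EuclideanSpace ℝ (Fin 1) ↦ (‖c‖ ^ 2)⁻¹) (𝓝[≠] 0) atTop :=
      tendsto_inv_nhdsGT_zero.comp h1
    exact tendsto_atTop_add_const_left _ (Rstar + 1) h2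
  -- the mass function is continuous
  have hM'cont : Continuous M' := by
    rw [continuous_iff_continuousAt]
    intro c
    by_cases hc : c = 0
    · subst hc
      rw [← continuousWithinAt_compl_self, ContinuousWithinAt, hM'0]
      have hev : (fun c ↦ m (radiusOf Rstar c)) =ᶠ[𝓝[≠] (0 : EuclideanSpace ℝ (Fin 1))] M' := by
        filter_upwards [self_mem_nhdsWithin] with c hc
        exact (hM'ne c hc).symm
      exact (hmM.comp hRc).congr' hev
    · have hev : (fun c ↦ m (radiusOf Rstar c)) =ᶠ[𝓝 c] M' := by
        filter_upwards [isOpen_ne.mem_nhds hc] with c' hc'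
        exact (hM'ne c' hc').symm
      have h1 : ContinuousAt (radiusOf Rstar) c :=
        (contDiffOn_radiusOf Rstar).continuousOn.continuousAt (isOpen_ne.mem_nhds hc)
      have h2 : ContinuousAt m (radiusOf Rstar c) :=
        hm.continuousAt (Ioi_mem_nhds (radiusOf_gt Rstar c))
      exact (h2.comp h1).congr hev
  -- decay of the members on the collared end
  have hDRF : ∀ c, (e.restrict hR.le).IsStronglyAsymptoticallyFlatDR (F c) (M' c) := by
    intro c
    rw [e.isStronglyAsymptoticallyFlatDR_restrict_iff hR.le]
    by_cases hc : c = 0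
    · subst hc
      rw [hF0, hM'0]
      exact hDR
    · rw [hFne c hc, hM'ne c hc]
      exact (hGR _ (radiusOf_gt Rstar c)).2.2.1.congr_of_eqOn_far (R₀ := Rstar)
        (fun q hq ↦ (hfarS _ _ q hq).1) (fun q hq ↦ (hfarS _ _ q hq).2)
  -- the weighted distance to the breathing curve of `d` vanishes at `c = 0`
  have hwF : Tendsto (fun c ↦ (e.restrict hR.le).wDist (F c) (AFEnd.breatheFamily B d (c 0)))
      (𝓝 0) (𝓝 0) := by
    have hmax : ∀ y : E3, Rstar < ‖y‖ → max Rstar e.R < ‖y‖ := fun y hy ↦ max_lt hy (hR.trans hy)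
    have hle : ∀ c ≠ 0, (e.restrict hR.le).wDist (F c) (AFEnd.breatheFamily B d (c 0)) ≤
        e.wDist (G (radiusOf Rstar c)) d := by
      intro c hc
      rw [hFne c hc]
      refine wDist_restrict_le_of_sub_eq e hR.le (fun y hy ↦ ?_) (fun y hy ↦ ?_)
      · rw [e.hCoeff_eq_of_agree_far (fun q hq ↦ (hfarS (radiusOf Rstar c) (c 0) q hq).1) (hmax y hy),
          e.hCoeff_eq_of_agree_far (fun q hq ↦ (hfarE (c 0) q hq).1) (hmax y hy)]
      · rw [e.kCoeff_eq_of_agree_far (fun q hq ↦ (hfarS (radiusOf Rstar c) (c 0) q hq).2) (hmax y hy),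
          e.kCoeff_eq_of_agree_far (fun q hq ↦ (hfarE (c 0) q hq).2) (hmax y hy)]
    have h0 : (e.restrict hR.le).wDist (F 0) (AFEnd.breatheFamily B d ((0 : EuclideanSpace ℝ (Fin 1)) 0)) = 0 := by
      rw [hF0, h00, AFEnd.breatheFamily_zero]
      exact AFEnd.wDist_self _ d
    have hne : Tendsto (fun c ↦ (e.restrict hR.le).wDist (F c) (AFEnd.breatheFamily B d (c 0)))
        (𝓝[≠] 0) (𝓝 0) := by
      refine tendsto_of_tendsto_of_tendsto_of_le_of_le' tendsto_const_nhds (hw.comp hRc)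
        (Eventually.of_forall fun c ↦ zero_le) ?_
      filter_upwards [self_mem_nhdsWithin] with c hc
      exact hle c hc
    have hpure : Tendsto (fun c ↦ (e.restrict hR.le).wDist (F c) (AFEnd.breatheFamily B d (c 0)))
        (pure 0) (𝓝 0) := by
      rw [tendsto_pure_left]
      intro s hs
      rw [h0]
      exact mem_of_mem_nhds hs
    have hsup := hne.sup hpure
    rwa [nhdsNE_sup_pure] at hsup
  -- `F c` has the sections of the breathing curve of `d` at every point, for `c` near `0`
  have hFF' : ∀ x : X, ∀ᶠ c in 𝓝 (0 : EuclideanSpace ℝ (Fin 1)),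
      (F c).h.inner x = (AFEnd.breatheFamily B d (c 0)).h.inner x ∧
        (F c).k x = (AFEnd.breatheFamily B d (c 0)).k x := by
    intro x
    obtain ⟨V, hV, ρ₀, hVρ⟩ := AFEnd.exists_nhds_forall_not_mem_far e x
    have hε : 0 < min 1 (max ρ₀ 1)⁻¹ :=
      lt_min one_pos (inv_pos.2 (lt_of_lt_of_le one_pos (le_max_right _ _)))
    filter_upwards [Metric.ball_mem_nhds (0 : EuclideanSpace ℝ (Fin 1)) hε] with c hc
    rw [Metric.mem_ball, dist_zero_right] at hc
    by_cases hc0 : c = 0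
    · subst hc0
      rw [hF0, h00, AFEnd.breatheFamily_zero]
      exact ⟨rfl, rfl⟩
    · have hfar : x ∉ e.far (radiusOf Rstar c) :=
        hVρ _ (le_radiusOf_of_norm_lt hRstar ρ₀ hc0 hc) _ (mem_of_mem_nhds hV)
      rw [hFne c hc0]
      exact hSE _ _ (radiusOf_gt Rstar c) x hfar
  -- TAME and IMMERSED by transfer from the breathing curve of `d`
  obtain ⟨htame, himm⟩ :=
    InitialDataSet.IsTameDataFamily.of_wDist_tendsto_of_forall_eventuallyEq
      (F := fun c : EuclideanSpace ℝ (Fin 1) ↦ AFEnd.breatheFamily B d (c 0)) (F' := F) (M' := M')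
      (AFEnd.isTameDataFamily_restrict_breatheCurve B d hsole hDR hR)
      (AFEnd.isImmersedAtZero_breatheCurve B d) hFsm
      (hF0.trans (AFEnd.breatheCurve_zero B d).symm) hM'cont hDRF hwF hFF'
  -- injective: read the centre marker
  have hinj : Injective F := by
    intro c c' hcc'
    have hv₀ : ((EuclideanSpace.single (0 : Fin 3) (1 : ℝ) : E3) :
        TangentSpace (𝓡 3) (e.dataChartExt z₀)) ≠ 0 := by
      have h : (EuclideanSpace.single (0 : Fin 3) (1 : ℝ) : E3) ≠ 0 := by
        rw [← norm_ne_zero_iff, PiLp.norm_single, norm_one]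
        exact one_ne_zero
      exact h
    have hx₀far : ∀ c : EuclideanSpace ℝ (Fin 1), c ≠ 0 → e.dataChartExt z₀ ∉ e.far (radiusOf Rstar c) :=
      fun c hc ↦ not_mem_far_of_mem_carrier e hzr (radiusOf_gt Rstar c).le (AFEnd.center_mem B).1
    have hread : ∀ c : EuclideanSpace ℝ (Fin 1),
        (F c).h.inner (e.dataChartExt z₀) = (AFEnd.breatheFamily B d (c 0)).h.inner (e.dataChartExt z₀) := by
      intro c
      by_cases hc : c = 0
      · subst hc
        rw [hF0, h00, AFEnd.breatheFamily_zero]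
      · rw [hFne c hc]
        exact (hSE _ _ (radiusOf_gt Rstar c) _ (hx₀far c hc)).1
    have hm : (AFEnd.breatheFamily B d (c 0)).h.inner (e.dataChartExt z₀)
          (EuclideanSpace.single (0 : Fin 3) (1 : ℝ) : E3) (EuclideanSpace.single (0 : Fin 3) (1 : ℝ) : E3) =
        (AFEnd.breatheFamily B d (c' 0)).h.inner (e.dataChartExt z₀)
          (EuclideanSpace.single (0 : Fin 3) (1 : ℝ) : E3) (EuclideanSpace.single (0 : Fin 3) (1 : ℝ) : E3) := by
      rw [← hread c, ← hread c', hcc']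
    have key : c 0 = c' 0 := AFEnd.injective_marker B d hv₀ hm
    ext i
    fin_cases i
    exact key
  -- admissible members
  have hadm : ∀ c, F c ∈ admissibleVacuumData X := by
    intro c
    by_cases hc : c = 0
    · subst hc
      rw [hF0]
      exact hd
    · rw [hFne c hc]
      obtain ⟨hGadm, -, -, -⟩ := hGR _ (radiusOf_gt Rstar c)
      have hvac : ∀ [(G (radiusOf Rstar c)).metric.HasLeviCivita],
          (G (radiusOf Rstar c)).IsVacuumConstraintSolution := fun {inst} ↦ (hGadm.1).1
      refine InitialDataSet.mem_admissibleVacuumData_of_agree_off_compact hGadm ?_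
        (AFEnd.isCompact_breatheCore B)
        (fun x hx ↦ AFEnd.breatheFamily_eq_of_not_mem_core B (G (radiusOf Rstar c)) (c 0) hx)
      intro inst
      haveI : (G (radiusOf Rstar c)).metric.HasLeviCivita := (G (radiusOf Rstar c)).metric.hasLeviCivita
      exact AFEnd.isVacuumConstraintSolution_breatheFamily B (G (radiusOf Rstar c)) hvac (c 0)
  -- Kerr-ended off `0`: breathing moves a compact core
  -- (tactic form: `HasExactKerrEnd` hides a `[Kerr.Facts]` binder, cf. `ExactKerrEnd.lean`, design notes)
  have hKE : ∀ c ≠ 0, (F c).HasExactKerrEnd := fun c hc ↦ by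
    rw [hFne c hc]
    intro inst
    obtain ⟨K, U, M₀, a, r₀, hM₀, φ, ψ, ν, hK⟩ := (hGR _ (radiusOf_gt Rstar c)).2.2.2
    exact ⟨K ∪ AFEnd.breatheCore e z₀ r, U, M₀, a, r₀, hM₀, φ, ψ, ν,
      hK.of_eq_off_compact (AFEnd.isCompact_breatheCore B)
        (fun _ hx ↦ (AFEnd.breatheFamily_eq_of_not_mem_core B (G (radiusOf Rstar c)) (c 0) hx).1)
        fun _ hx ↦ (AFEnd.breatheFamily_eq_of_not_mem_core B (G (radiusOf Rstar c)) (c 0) hx).2⟩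
  exact ⟨e.restrict hR.le, F, htame, himm, hF0, hinj, hadm, hKE⟩

end Summit.FinalStateConjecture.FinalStateConjecture.Theorems.ExactKerrEnds

end
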